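import Literature.NumberTheory.LFunctions.LargeValuesS2AFE
import Literature.NumberTheory.LFunctions.LargeValuesRFunction
import Mathlib.MeasureTheory.Integral.Prod
import Mathlib.MeasureTheory.Measure.Haar.NormedSpace
import HarnessLib

/-!
# `S₃` as a sum of oscillatory integrals: Guth–Maynard §7 (Proposition 7.1, the key cancellation)

Topic `NumberTheory/LFunctions`, family RH. Part of the programme around the tree's named fact
`Literature.NumberTheory.LFunctions.zeroDensity_guth_maynard` (L. Guth, J. Maynard, *New large value
estimates for Dirichlet polynomials*, Ann. of Math. 203 (2026), Theorem 1.2), which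
`LargeValuesEnergyBound.lean` reduces to Proposition 10.1 of the paper (the refined `S₃` bound,
§§7–10). This file PROVES the content of §7 up to and including Proposition 7.1 ("Cancellation
within the `I_m` integrals"), in an exact quantitative form, for the objects `S3`, `coefB` of
`LargeValuesTraceExpansion.lean`:

* §1 `Mset M = {m ∈ ℤ : 0 < |m| ≤ M}`, the truncated coefficient `coefBflat` (`B♭(τ) = ∑_{m∈𝓜} ĥ_τ(Nm)`),
  the terms `Im` (`I_m = N³∑_{t₁,t₂,t₃} ĥ_{t₁−t₂}(m₁N)ĥ_{t₂−t₃}(m₂N)ĥ_{t₃−t₁}(m₃N)`, eq. (7.1)), the expansion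
  `N³∑ B♭B♭B♭ = ∑_{m∈𝓜³} I_m` (`S3flat_eq_sum_Im`) and the truncation error
  `|S₃ − ∑_{m∈𝓜³} I_m| ≤ 3|W|³N³γ(β+γ)²` from `|B| ≤ β`, `|B − B♭| ≤ γ` (`norm_S3_sub_sum_Im_le`; `β`, `γ` are
  supplied by `GuthMaynardFourier.norm_coefB_le` and `norm_coefB_sub_coefBflat_le`, i.e.
  `GuthMaynardS2.norm_coefB_sub_sum_le`: "`I_m` is negligible unless `|m| ⪅ T/N`", eq. (7.2));
* §2 the pointwise identity `∑_{t₁,t₂,t₃} h_{t₁−t₂}(u₁)h_{t₂−t₃}(u₂)h_{t₃−t₁}(u₃) = w²w²w² R(u₁/u₃)R(u₂/u₁)R(u₃/u₂)`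
  (`sum_hFun_mul_eq`, the step (7.3));
* §3 the amplitude `Φ_{v₁,v₂}(u) = u²w(uv₁)²w(uv₂)²w(u)²` of the `u₃`-integral after the change of variables
  `u₁ = v₁u₃`, `u₂ = v₂u₃` (eq. (7.4)): smooth, supported in `[1,2]`, vanishing unless `v₁,v₂ ∈ [1/2,2]`,
  with `|Φ̂_{v₁,v₂}(ξ)| ≤ D(1+|ξ|)^{-j}` uniformly (`norm_fourier_Phi_le`: non-stationary phase, the tree's
  `GuthMaynardFourier.norm_fourier_le_of_iteratedDeriv`);
* §4 **Proposition 7.1**: `I_m = N³∫∫ R(v₁)R(v₂/v₁)R(1/v₂) Φ̂_{v₁,v₂}(N(m₁v₁+m₂v₂+m₃)) dv₁dv₂`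
  (`Im_eq_integral`: Fubini on `ℝ³`, the two substitutions, Fubini again) and the bound
  `|I_m| ≤ N³ ∫_{[1/2,2]}∫_{[1/2,2]} |R(v₁)||R(v₂/v₁)||R(v₂)| D(1+|N(m₁v₁+m₂v₂+m₃)|)^{-j} dv₂dv₁`
  (`norm_Im_le`), i.e. "`|I_m| ≪ N³∫_{|m₁v₁+m₂v₂+m₃| ⪅ 1/N} |R(v₁)R(v₂/v₁)R(v₂)| + O(T^{-200})`".

Definitions (with bodies): `Mset`, `coefBflat`, `Im`, `ech`, `wSq2`, `Phi`. No named fact is introduced;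
everything in this file is proved.

## References

* L. Guth, J. Maynard, *New large value estimates for Dirichlet polynomials*, Ann. of Math. (2)
  203 (2026), no. 2; arXiv:2405.20552 (2024): §7, eqs. (7.1)–(7.5), Proposition 7.1 and its proof.
-/

noncomputable section

open Real Set Filter Topology Complex MeasureTheory Finset
open scoped FourierTransform ContDiff

namespace Literature.NumberTheory.LFunctions

namespace GuthMaynardS3

open GuthMaynardFourier GuthMaynardRFunction

/-! ## §1. Truncation of `B` and the terms `I_m` -/

/-- `𝓜_M = {m ∈ ℤ : 0 < |m| ≤ M}`. [cite: GuthMaynard2026, (7.2)] -/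
def Mset (M : ℕ) : Finset ℤ := (Finset.Icc (-(M : ℤ)) M).erase 0

/-- The truncated coefficient `B♭(τ) = ∑_{0<|m|≤M} ĥ_τ(Nm)`. [cite: GuthMaynard2026, (7.2)] -/
def coefBflat (w : ℝ → ℝ) (N : ℝ) (M : ℕ) (τ : ℝ) : ℂ := ∑ m ∈ Mset M, 𝓕 (hFun w τ) (N * m)

/-- `I_m = N³ ∑_{t₁,t₂,t₃∈W} ĥ_{t₁−t₂}(m₁N) ĥ_{t₂−t₃}(m₂N) ĥ_{t₃−t₁}(m₃N)`. [cite: GuthMaynard2026, (7.1)] -/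
def Im (w : ℝ → ℝ) (N : ℕ) (W : Finset ℝ) (m : ℤ × ℤ × ℤ) : ℂ :=
  (N : ℂ) ^ 3 * ∑ t₁ ∈ W, ∑ t₂ ∈ W, ∑ t₃ ∈ W,
    𝓕 (hFun w (t₁ - t₂)) (N * m.1) * 𝓕 (hFun w (t₂ - t₃)) (N * m.2.1) *
      𝓕 (hFun w (t₃ - t₁)) (N * m.2.2)

/-- `(∑f)(∑g)(∑h) = ∑∑∑ f g h`. [folklore] -/
theorem sum_mul_sum_mul_sum {ι : Type*} (s : Finset ι) (f g h : ι → ℂ) :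
    (∑ i ∈ s, f i) * (∑ j ∈ s, g j) * (∑ k ∈ s, h k) = ∑ i ∈ s, ∑ j ∈ s, ∑ k ∈ s, f i * g j * h k := by
  rw [Finset.sum_mul_sum, Finset.sum_mul]
  refine Finset.sum_congr rfl fun i _ ↦ ?_
  rw [Finset.sum_mul]
  refine Finset.sum_congr rfl fun j _ ↦ ?_
  rw [Finset.mul_sum]

/-- Membership in `𝓜_M`. [folklore] -/
theorem mem_Mset {M : ℕ} {m : ℤ} : m ∈ Mset M ↔ m ≠ 0 ∧ -(M : ℤ) ≤ m ∧ m ≤ M := by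
  simp [Mset]

/-- `∑_{m∈𝓜_M} F(m) = ∑_{n=1}^{M} (F(n) + F(−n))`. [folklore] -/
theorem sum_Mset_eq (M : ℕ) (F : ℤ → ℂ) :
    ∑ m ∈ Mset M, F m = ∑ n ∈ Finset.Icc 1 M, (F n + F (-(n : ℤ))) := by
  classical
  have h1 : Mset M = (Finset.Icc 1 M).image (fun n : ℕ ↦ (n : ℤ)) ∪
      (Finset.Icc 1 M).image (fun n : ℕ ↦ -(n : ℤ)) := by
    ext m
    simp only [mem_Mset, Finset.mem_union, Finset.mem_image, Finset.mem_Icc]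
    constructor
    · rintro ⟨hm0, hm1, hm2⟩
      rcases lt_or_gt_of_ne hm0 with h | h
      · exact Or.inr ⟨m.natAbs, ⟨by omega, by omega⟩, by omega⟩
      · exact Or.inl ⟨m.natAbs, ⟨by omega, by omega⟩, by omega⟩
    · rintro (⟨n, ⟨hn1, hn2⟩, rfl⟩ | ⟨n, ⟨hn1, hn2⟩, rfl⟩) <;> omega
  have hdisj : Disjoint ((Finset.Icc 1 M).image (fun n : ℕ ↦ (n : ℤ)))
      ((Finset.Icc 1 M).image (fun n : ℕ ↦ -(n : ℤ))) := by
    rw [Finset.disjoint_left]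
    intro m hm hm'
    rw [Finset.mem_image] at hm hm'
    obtain ⟨n, hn, rfl⟩ := hm
    obtain ⟨n', hn', h⟩ := hm'
    rw [Finset.mem_Icc] at hn hn'
    omega
  have hinj1 : Set.InjOn (fun n : ℕ ↦ (n : ℤ)) (Finset.Icc 1 M) := by
    intro a _ b _ h
    have h' : (a : ℤ) = b := h
    exact_mod_cast h'
  have hinj2 : Set.InjOn (fun n : ℕ ↦ -(n : ℤ)) (Finset.Icc 1 M) := by
    intro a _ b _ h
    have h' : -(a : ℤ) = -b := h
    have : (a : ℤ) = b := neg_injective h'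
    exact_mod_cast this
  rw [h1, Finset.sum_union hdisj, Finset.sum_image hinj1, Finset.sum_image hinj2,
    ← Finset.sum_add_distrib]

section weight

variable {w : ℝ → ℝ}

/-- `B♭` in the form of `GuthMaynardS2.norm_coefB_sub_sum_le`:
`B♭(τ) = ∑_{m=1}^{M} (ĥ_τ(Nm) + ĥ_τ(−Nm))`. [folklore] -/
theorem coefBflat_eq_sum_Icc (N : ℝ) (M : ℕ) (τ : ℝ) :
    coefBflat w N M τ = ∑ m ∈ Finset.Icc 1 M, (𝓕 (hFun w τ) (N * m) + 𝓕 (hFun w τ) (-(N * m))) := by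
  rw [coefBflat, sum_Mset_eq]
  refine Finset.sum_congr rfl fun n _ ↦ ?_
  push_cast
  rw [mul_neg]

/-- **Truncation of `B` (eq. (7.2))**: for `j ≥ 2` there is `C` with
`|B_N(τ) − B♭_M(τ)| ≤ C(1+|τ|)^j N^{-j} M^{2−j}` for `N, M ≥ 1` ("`I_m` is negligible unless
`|m| ⪅ T/N`"). [cite: GuthMaynard2026, (7.2)] -/
theorem norm_coefB_sub_coefBflat_le (hw : ContDiff ℝ ∞ w) (hsupp : Function.support w ⊆ Set.Icc 1 2)
    {j : ℕ} (hj : 2 ≤ j) : ∃ C, 0 ≤ C ∧ ∀ (τ N : ℝ), 1 ≤ N → ∀ M : ℕ, 1 ≤ M →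
      ‖coefB w N τ - coefBflat w N M τ‖ ≤ C * (1 + |τ|) ^ j / (N ^ j * (M : ℝ) ^ (j - 2)) := by
  obtain ⟨C, hC0, hC⟩ := GuthMaynardS2.norm_coefB_sub_sum_le hw hsupp hj
  refine ⟨C, hC0, fun τ N hN M hM ↦ ?_⟩
  rw [coefBflat_eq_sum_Icc]
  exact hC τ N hN M hM

/-- **`N³ ∑_{t₁,t₂,t₃} B♭B♭B♭ = ∑_{m ∈ 𝓜³} I_m`** (expanding the three finite sums).
[cite: GuthMaynard2026, (7.1)–(7.2)] -/
theorem S3flat_eq_sum_Im (N : ℕ) (W : Finset ℝ) (M : ℕ) :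
    (N : ℂ) ^ 3 * ∑ t₁ ∈ W, ∑ t₂ ∈ W, ∑ t₃ ∈ W,
      coefBflat w N M (t₁ - t₂) * coefBflat w N M (t₂ - t₃) * coefBflat w N M (t₃ - t₁) =
      ∑ m ∈ Mset M ×ˢ (Mset M ×ˢ Mset M), Im w N W m := by
  -- expand the products of sums
  have hexp : ∀ t₁ t₂ t₃ : ℝ, coefBflat w N M (t₁ - t₂) * coefBflat w N M (t₂ - t₃) * coefBflat w N M (t₃ - t₁) =
      ∑ m₁ ∈ Mset M, ∑ m₂ ∈ Mset M, ∑ m₃ ∈ Mset M,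
        𝓕 (hFun w (t₁ - t₂)) (N * m₁) * 𝓕 (hFun w (t₂ - t₃)) (N * m₂) * 𝓕 (hFun w (t₃ - t₁)) (N * m₃) := by
    intro t₁ t₂ t₃
    simp only [coefBflat]
    exact sum_mul_sum_mul_sum _ _ _ _
  -- exchange the `t`- and `m`-sums
  have hswap : ∑ t₁ ∈ W, ∑ t₂ ∈ W, ∑ t₃ ∈ W, ∑ m₁ ∈ Mset M, ∑ m₂ ∈ Mset M, ∑ m₃ ∈ Mset M,
      𝓕 (hFun w (t₁ - t₂)) (N * m₁) * 𝓕 (hFun w (t₂ - t₃)) (N * m₂) * 𝓕 (hFun w (t₃ - t₁)) (N * m₃) =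
      ∑ m₁ ∈ Mset M, ∑ m₂ ∈ Mset M, ∑ m₃ ∈ Mset M, ∑ t₁ ∈ W, ∑ t₂ ∈ W, ∑ t₃ ∈ W,
      𝓕 (hFun w (t₁ - t₂)) (N * m₁) * 𝓕 (hFun w (t₂ - t₃)) (N * m₂) * 𝓕 (hFun w (t₃ - t₁)) (N * m₃) := by
    calc ∑ t₁ ∈ W, ∑ t₂ ∈ W, ∑ t₃ ∈ W, ∑ m₁ ∈ Mset M, ∑ m₂ ∈ Mset M, ∑ m₃ ∈ Mset M,
          𝓕 (hFun w (t₁ - t₂)) (N * m₁) * 𝓕 (hFun w (t₂ - t₃)) (N * m₂) * 𝓕 (hFun w (t₃ - t₁)) (N * m₃)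
        = ∑ t₁ ∈ W, ∑ t₂ ∈ W, ∑ m₁ ∈ Mset M, ∑ t₃ ∈ W, ∑ m₂ ∈ Mset M, ∑ m₃ ∈ Mset M,
          𝓕 (hFun w (t₁ - t₂)) (N * m₁) * 𝓕 (hFun w (t₂ - t₃)) (N * m₂) * 𝓕 (hFun w (t₃ - t₁)) (N * m₃) := by
          refine Finset.sum_congr rfl fun t₁ _ ↦ Finset.sum_congr rfl fun t₂ _ ↦ ?_
          rw [Finset.sum_comm]
      _ = ∑ t₁ ∈ W, ∑ m₁ ∈ Mset M, ∑ t₂ ∈ W, ∑ t₃ ∈ W, ∑ m₂ ∈ Mset M, ∑ m₃ ∈ Mset M,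
          𝓕 (hFun w (t₁ - t₂)) (N * m₁) * 𝓕 (hFun w (t₂ - t₃)) (N * m₂) * 𝓕 (hFun w (t₃ - t₁)) (N * m₃) := by
          refine Finset.sum_congr rfl fun t₁ _ ↦ ?_
          rw [Finset.sum_comm]
      _ = ∑ m₁ ∈ Mset M, ∑ t₁ ∈ W, ∑ t₂ ∈ W, ∑ t₃ ∈ W, ∑ m₂ ∈ Mset M, ∑ m₃ ∈ Mset M,
          𝓕 (hFun w (t₁ - t₂)) (N * m₁) * 𝓕 (hFun w (t₂ - t₃)) (N * m₂) * 𝓕 (hFun w (t₃ - t₁)) (N * m₃) := by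
          rw [Finset.sum_comm]
      _ = _ := Finset.sum_congr rfl fun m₁ _ ↦ ?_
    calc ∑ t₁ ∈ W, ∑ t₂ ∈ W, ∑ t₃ ∈ W, ∑ m₂ ∈ Mset M, ∑ m₃ ∈ Mset M,
          𝓕 (hFun w (t₁ - t₂)) (N * m₁) * 𝓕 (hFun w (t₂ - t₃)) (N * m₂) * 𝓕 (hFun w (t₃ - t₁)) (N * m₃)
        = ∑ t₁ ∈ W, ∑ t₂ ∈ W, ∑ m₂ ∈ Mset M, ∑ t₃ ∈ W, ∑ m₃ ∈ Mset M,
          𝓕 (hFun w (t₁ - t₂)) (N * m₁) * 𝓕 (hFun w (t₂ - t₃)) (N * m₂) * 𝓕 (hFun w (t₃ - t₁)) (N * m₃) := by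
          refine Finset.sum_congr rfl fun t₁ _ ↦ Finset.sum_congr rfl fun t₂ _ ↦ ?_
          rw [Finset.sum_comm]
      _ = ∑ t₁ ∈ W, ∑ m₂ ∈ Mset M, ∑ t₂ ∈ W, ∑ t₃ ∈ W, ∑ m₃ ∈ Mset M,
          𝓕 (hFun w (t₁ - t₂)) (N * m₁) * 𝓕 (hFun w (t₂ - t₃)) (N * m₂) * 𝓕 (hFun w (t₃ - t₁)) (N * m₃) := by
          refine Finset.sum_congr rfl fun t₁ _ ↦ ?_
          rw [Finset.sum_comm]
      _ = ∑ m₂ ∈ Mset M, ∑ t₁ ∈ W, ∑ t₂ ∈ W, ∑ t₃ ∈ W, ∑ m₃ ∈ Mset M,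
          𝓕 (hFun w (t₁ - t₂)) (N * m₁) * 𝓕 (hFun w (t₂ - t₃)) (N * m₂) * 𝓕 (hFun w (t₃ - t₁)) (N * m₃) := by
          rw [Finset.sum_comm]
      _ = ∑ m₂ ∈ Mset M, ∑ m₃ ∈ Mset M, ∑ t₁ ∈ W, ∑ t₂ ∈ W, ∑ t₃ ∈ W,
          𝓕 (hFun w (t₁ - t₂)) (N * m₁) * 𝓕 (hFun w (t₂ - t₃)) (N * m₂) * 𝓕 (hFun w (t₃ - t₁)) (N * m₃) := by
          refine Finset.sum_congr rfl fun m₂ _ ↦ ?_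
          calc ∑ t₁ ∈ W, ∑ t₂ ∈ W, ∑ t₃ ∈ W, ∑ m₃ ∈ Mset M,
                𝓕 (hFun w (t₁ - t₂)) (N * m₁) * 𝓕 (hFun w (t₂ - t₃)) (N * m₂) * 𝓕 (hFun w (t₃ - t₁)) (N * m₃)
              = ∑ t₁ ∈ W, ∑ t₂ ∈ W, ∑ m₃ ∈ Mset M, ∑ t₃ ∈ W,
                𝓕 (hFun w (t₁ - t₂)) (N * m₁) * 𝓕 (hFun w (t₂ - t₃)) (N * m₂) * 𝓕 (hFun w (t₃ - t₁)) (N * m₃) := by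
                refine Finset.sum_congr rfl fun t₁ _ ↦ Finset.sum_congr rfl fun t₂ _ ↦ ?_
                rw [Finset.sum_comm]
            _ = ∑ t₁ ∈ W, ∑ m₃ ∈ Mset M, ∑ t₂ ∈ W, ∑ t₃ ∈ W,
                𝓕 (hFun w (t₁ - t₂)) (N * m₁) * 𝓕 (hFun w (t₂ - t₃)) (N * m₂) * 𝓕 (hFun w (t₃ - t₁)) (N * m₃) := by
                refine Finset.sum_congr rfl fun t₁ _ ↦ ?_
                rw [Finset.sum_comm]
            _ = _ := by rw [Finset.sum_comm]
  -- both sides as iterated sums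
  rw [Finset.sum_product]
  simp_rw [Finset.sum_product]
  simp only [Im]
  simp_rw [hexp]
  rw [hswap, Finset.mul_sum]
  refine Finset.sum_congr rfl fun m₁ _ ↦ ?_
  rw [Finset.mul_sum]
  refine Finset.sum_congr rfl fun m₂ _ ↦ ?_
  rw [Finset.mul_sum]

/-- **The truncation error for `S₃`**: if `|B(t−t')| ≤ β` and `|B(t−t') − B♭(t−t')| ≤ γ` for all
`t, t' ∈ W`, then `|S₃ − ∑_{m∈𝓜³} I_m| ≤ N³|W|³ · 3γ(β+γ)²` (from
`abc − a'b'c' = (a−a')bc + a'(b−b')c + a'b'(c−c')`). With `M = ⌈N^η T/N⌉` and Lemma 4.3 this is the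
step "`S₃ = ∑_{0<|m_i| ⪅ T/N} I_m + O(T^{-100})`". [cite: GuthMaynard2026, (7.2)] -/
theorem norm_S3_sub_sum_Im_le (N : ℕ) (W : Finset ℝ) (M : ℕ) {β γ : ℝ} (hβ0 : 0 ≤ β) (hγ0 : 0 ≤ γ)
    (hβ : ∀ t ∈ W, ∀ t' ∈ W, ‖coefB w N (t - t')‖ ≤ β)
    (hγ : ∀ t ∈ W, ∀ t' ∈ W, ‖coefB w N (t - t') - coefBflat w N M (t - t')‖ ≤ γ) :
    ‖S3 w N W - ∑ m ∈ Mset M ×ˢ (Mset M ×ˢ Mset M), Im w N W m‖ ≤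
      (N : ℝ) ^ 3 * (W.card : ℝ) ^ 3 * (3 * γ * (β + γ) ^ 2) := by
  rw [← S3flat_eq_sum_Im, S3, ← mul_sub, norm_mul]
  have hN : ‖((N : ℂ)) ^ 3‖ = (N : ℝ) ^ 3 := by simp
  rw [hN, mul_assoc]
  refine mul_le_mul_of_nonneg_left ?_ (by positivity)
  rw [← Finset.sum_sub_distrib]
  have hflat : ∀ t ∈ W, ∀ t' ∈ W, ‖coefBflat w N M (t - t')‖ ≤ β + γ := by
    intro t ht t' ht'
    have h1 := hβ t ht t' ht'
    have h2 := hγ t ht t' ht'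
    calc ‖coefBflat w N M (t - t')‖ = ‖coefB w N (t - t') - (coefB w N (t - t') - coefBflat w N M (t - t'))‖ := by
          rw [sub_sub_cancel]
      _ ≤ ‖coefB w N (t - t')‖ + ‖coefB w N (t - t') - coefBflat w N M (t - t')‖ := norm_sub_le _ _
      _ ≤ β + γ := add_le_add h1 h2
  -- the elementary bound for `abc − a'b'c'`
  have hkey : ∀ a b c a' b' c' : ℂ, ‖a‖ ≤ β → ‖b‖ ≤ β → ‖c‖ ≤ β → ‖a - a'‖ ≤ γ → ‖b - b'‖ ≤ γ →
      ‖c - c'‖ ≤ γ → ‖a'‖ ≤ β + γ → ‖b'‖ ≤ β + γ →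
      ‖a * b * c - a' * b' * c'‖ ≤ 3 * γ * (β + γ) ^ 2 := by
    intro a b c a' b' c' ha hb hc ha' hb' hc' ha'' hb''
    have e : a * b * c - a' * b' * c' = (a - a') * b * c + a' * (b - b') * c + a' * b' * (c - c') := by ring
    rw [e]
    have hβ1 : β ≤ β + γ := by linarith
    calc ‖(a - a') * b * c + a' * (b - b') * c + a' * b' * (c - c')‖
        ≤ ‖(a - a') * b * c‖ + ‖a' * (b - b') * c‖ + ‖a' * b' * (c - c')‖ := norm_add₃_le
      _ = ‖a - a'‖ * ‖b‖ * ‖c‖ + ‖a'‖ * ‖b - b'‖ * ‖c‖ + ‖a'‖ * ‖b'‖ * ‖c - c'‖ := by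
          simp only [norm_mul]
      _ ≤ γ * (β + γ) * (β + γ) + (β + γ) * γ * (β + γ) + (β + γ) * (β + γ) * γ := by
          gcongr
          · exact hb.trans hβ1
          · exact hc.trans hβ1
          · exact hc.trans hβ1
      _ = 3 * γ * (β + γ) ^ 2 := by ring
  calc ‖∑ t₁ ∈ W, (∑ t₂ ∈ W, ∑ t₃ ∈ W, coefB w N (t₁ - t₂) * coefB w N (t₂ - t₃) * coefB w N (t₃ - t₁) -
        ∑ t₂ ∈ W, ∑ t₃ ∈ W, coefBflat w N M (t₁ - t₂) * coefBflat w N M (t₂ - t₃) * coefBflat w N M (t₃ - t₁))‖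
      ≤ ∑ t₁ ∈ W, ‖∑ t₂ ∈ W, ∑ t₃ ∈ W, coefB w N (t₁ - t₂) * coefB w N (t₂ - t₃) * coefB w N (t₃ - t₁) -
        ∑ t₂ ∈ W, ∑ t₃ ∈ W, coefBflat w N M (t₁ - t₂) * coefBflat w N M (t₂ - t₃) * coefBflat w N M (t₃ - t₁)‖ :=
        norm_sum_le _ _
    _ ≤ ∑ t₁ ∈ W, ∑ t₂ ∈ W, ∑ t₃ ∈ W, (3 * γ * (β + γ) ^ 2) := by
        refine Finset.sum_le_sum fun t₁ h₁ ↦ ?_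
        rw [← Finset.sum_sub_distrib]
        refine (norm_sum_le _ _).trans (Finset.sum_le_sum fun t₂ h₂ ↦ ?_)
        rw [← Finset.sum_sub_distrib]
        refine (norm_sum_le _ _).trans (Finset.sum_le_sum fun t₃ h₃ ↦ ?_)
        exact hkey _ _ _ _ _ _ (hβ t₁ h₁ t₂ h₂) (hβ t₂ h₂ t₃ h₃) (hβ t₃ h₃ t₁ h₁) (hγ t₁ h₁ t₂ h₂)
          (hγ t₂ h₂ t₃ h₃) (hγ t₃ h₃ t₁ h₁) (hflat t₁ h₁ t₂ h₂) (hflat t₂ h₂ t₃ h₃)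
    _ = (W.card : ℝ) ^ 3 * (3 * γ * (β + γ) ^ 2) := by
        simp only [Finset.sum_const, nsmul_eq_mul]; ring

/-! ## §2. The triple `t`-sum factorises through `R` (eq. (7.3)) -/

/-- For `u₁, u₂, u₃ > 0`: `u₁^{i(t₁−t₂)} u₂^{i(t₂−t₃)} u₃^{i(t₃−t₁)} = (u₁/u₃)^{it₁} (u₂/u₁)^{it₂} (u₃/u₂)^{it₃}`.
[cite: GuthMaynard2026, (7.3)] -/
theorem ePow_triple {u₁ u₂ u₃ : ℝ} (h₁ : 0 < u₁) (h₂ : 0 < u₂) (h₃ : 0 < u₃) (t₁ t₂ t₃ : ℝ) :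
    ePow ((((t₁ - t₂ : ℝ)) : ℂ) * I) u₁ * ePow ((((t₂ - t₃ : ℝ)) : ℂ) * I) u₂ * ePow ((((t₃ - t₁ : ℝ)) : ℂ) * I) u₃ =
      ePow ((t₁ : ℂ) * I) (u₁ / u₃) * ePow ((t₂ : ℂ) * I) (u₂ / u₁) * ePow ((t₃ : ℂ) * I) (u₃ / u₂) := by
  simp only [ePow, ← Complex.exp_add]
  rw [Real.log_div h₁.ne' h₃.ne', Real.log_div h₂.ne' h₁.ne', Real.log_div h₃.ne' h₂.ne']
  congr 1
  push_cast
  ring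

/-- **Eq. (7.3)**: `∑_{t₁,t₂,t₃∈W} h_{t₁−t₂}(u₁)h_{t₂−t₃}(u₂)h_{t₃−t₁}(u₃) = w(u₁)²w(u₂)²w(u₃)² R(u₁/u₃)R(u₂/u₁)R(u₃/u₂)`
(for all real `u_i`; both sides vanish unless all `u_i ∈ [1,2]`). [cite: GuthMaynard2026, (7.3)] -/
theorem sum_hFun_mul_eq (hsupp : Function.support w ⊆ Set.Icc 1 2) (W : Finset ℝ) (u₁ u₂ u₃ : ℝ) :
    ∑ t₁ ∈ W, ∑ t₂ ∈ W, ∑ t₃ ∈ W, hFun w (t₁ - t₂) u₁ * hFun w (t₂ - t₃) u₂ * hFun w (t₃ - t₁) u₃ =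
      wSq w u₁ * wSq w u₂ * wSq w u₃ * (Rfun W (u₁ / u₃) * Rfun W (u₂ / u₁) * Rfun W (u₃ / u₂)) := by
  by_cases h : u₁ ∈ Set.Icc 1 2 ∧ u₂ ∈ Set.Icc 1 2 ∧ u₃ ∈ Set.Icc 1 2
  · obtain ⟨hu₁, hu₂, hu₃⟩ := h
    have h₁ : 0 < u₁ := lt_of_lt_of_le one_pos hu₁.1
    have h₂ : 0 < u₂ := lt_of_lt_of_le one_pos hu₂.1
    have h₃ : 0 < u₃ := lt_of_lt_of_le one_pos hu₃.1
    have hterm : ∀ t₁ t₂ t₃ : ℝ, hFun w (t₁ - t₂) u₁ * hFun w (t₂ - t₃) u₂ * hFun w (t₃ - t₁) u₃ =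
        wSq w u₁ * wSq w u₂ * wSq w u₃ * (ePow ((t₁ : ℂ) * I) |u₁ / u₃| * ePow ((t₂ : ℂ) * I) |u₂ / u₁| *
          ePow ((t₃ : ℂ) * I) |u₃ / u₂|) := by
      intro t₁ t₂ t₃
      rw [abs_of_pos (div_pos h₁ h₃), abs_of_pos (div_pos h₂ h₁), abs_of_pos (div_pos h₃ h₂),
        ← ePow_triple h₁ h₂ h₃]
      simp only [hFun, wSq]
      push_cast
      ring
    simp_rw [hterm]
    simp only [Rfun, ← Finset.mul_sum]
    congr 1
    rw [Finset.sum_mul_sum, Finset.sum_mul]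
    exact Finset.sum_congr rfl fun t₁ _ ↦ by rw [Finset.sum_mul]
  · -- some `u_i ∉ [1,2]`: both sides vanish
    have hz : hFun w 0 u₁ = 0 ∨ hFun w 0 u₂ = 0 ∨ hFun w 0 u₃ = 0 := by
      simp only [not_and_or] at h
      rcases h with h | h | h
      · exact Or.inl (hFun_eq_zero_of_notMem hsupp 0 h)
      · exact Or.inr (Or.inl (hFun_eq_zero_of_notMem hsupp 0 h))
      · exact Or.inr (Or.inr (hFun_eq_zero_of_notMem hsupp 0 h))
    have hw0 : ∀ {u : ℝ}, hFun w 0 u = 0 → wSq w u = 0 := by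
      intro u hu
      simp only [hFun, ePow] at hu
      simpa [wSq, Complex.exp_ne_zero] using hu
    have hh0 : ∀ {u : ℝ} (τ : ℝ), hFun w 0 u = 0 → hFun w τ u = 0 := by
      intro u τ hu
      rw [hFun_eq_mul, Pi.mul_apply, hw0 hu, zero_mul]
    rcases hz with hz | hz | hz
    · simp [hh0 _ hz, hw0 hz]
    · simp [hh0 _ hz, hw0 hz]
    · simp [hh0 _ hz, hw0 hz]

end weight

/-! ## §3. The amplitude `Φ_{v₁,v₂}` of the `u₃`-integral and its Fourier decay -/

/-- The additive character `e(x) = exp(2πix)` as a complex number (the coercion of Mathlib's `𝐞 x`).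
[folklore] -/
def ech (x : ℝ) : ℂ := Complex.exp (↑(2 * π * x) * Complex.I)

/-- `(𝐞 x : ℂ) = ech x`. [folklore] -/
theorem fourierChar_coe (x : ℝ) : ((𝐞 x : Circle) : ℂ) = ech x := rfl

/-- `|e(x)| = 1`. [folklore] -/
theorem norm_ech (x : ℝ) : ‖ech x‖ = 1 := by
  rw [ech, show ((2 * π * x : ℝ) : ℂ) * Complex.I = ((2 * π * x : ℝ) : ℂ) * I from rfl,
    Complex.norm_exp_ofReal_mul_I]

/-- `e(x + y) = e(x) e(y)`. [folklore] -/
theorem ech_add (x y : ℝ) : ech (x + y) = ech x * ech y := by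
  rw [ech, ech, ech, ← Complex.exp_add]
  congr 1; push_cast; ring

/-- `e` is continuous. [folklore] -/
theorem continuous_ech : Continuous ech := by
  unfold ech; fun_prop

/-- The Fourier integral written with `ech`: `f̂(ξ) = ∫ e(−uξ) f(u) du`. [folklore] -/
theorem fourier_eq_integral_ech (f : ℝ → ℂ) (ξ : ℝ) : 𝓕 f ξ = ∫ u, ech (-(u * ξ)) * f u := by
  rw [Real.fourier_real_eq]
  refine integral_congr_ae (Eventually.of_forall fun u ↦ ?_)
  simp only [Circle.smul_def, smul_eq_mul, fourierChar_coe]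

section weight

variable {w : ℝ → ℝ}

/-- `u²w(u)²` as a complex function: smooth and supported in `[1,2]`. [cite: GuthMaynard2026, (7.4)] -/
def wSq2 (w : ℝ → ℝ) : ℝ → ℂ := fun u ↦ (((u ^ 2 * (w u) ^ 2 : ℝ)) : ℂ)

/-- The amplitude `Φ_{v₁,v₂}(u) = w(uv₁)² w(uv₂)² · u²w(u)²` of the `u₃`-integral after the change of
variables `u₁ = v₁u₃`, `u₂ = v₂u₃` (the paper's `w₂(u₃,v₁,v₂)`). [cite: GuthMaynard2026, (7.4)] -/
def Phi (w : ℝ → ℝ) (v₁ v₂ : ℝ) : ℝ → ℂ :=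
  fun u ↦ wSq w (u * v₁) * wSq w (u * v₂) * wSq2 w u

/-- `u²w²` is smooth. [folklore] -/
theorem wSq2_contDiff (hw : ContDiff ℝ ∞ w) : ContDiff ℝ ∞ (wSq2 w) := by
  unfold wSq2
  exact Complex.ofRealCLM.contDiff.comp ((contDiff_id.pow 2).mul (hw.pow 2))

/-- `u²w²` is supported in `[1,2]`. [folklore] -/
theorem tsupport_wSq2_subset (hsupp : Function.support w ⊆ Set.Icc 1 2) :
    tsupport (wSq2 w) ⊆ Set.Icc 1 2 := by
  refine closure_minimal (fun x hx ↦ hsupp ?_) isClosed_Icc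
  rw [Function.mem_support] at hx ⊢
  intro h
  apply hx
  simp [wSq2, h]

/-- `Φ_{v₁,v₂}(u) = u² w(uv₁)² w(uv₂)² w(u)²` as a real number. [cite: GuthMaynard2026, (7.4)] -/
theorem Phi_apply (v₁ v₂ u : ℝ) :
    Phi w v₁ v₂ u = (((u ^ 2 * ((w (u * v₁)) ^ 2 * (w (u * v₂)) ^ 2 * (w u) ^ 2) : ℝ)) : ℂ) := by
  simp only [Phi, wSq, wSq2]
  push_cast
  ring

/-- `Φ_{v₁,v₂}` vanishes off `[1,2]`. [cite: GuthMaynard2026, (7.4)] -/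
theorem Phi_eq_zero_of_notMem (hsupp : Function.support w ⊆ Set.Icc 1 2) (v₁ v₂ : ℝ) {u : ℝ}
    (hu : u ∉ Set.Icc 1 2) : Phi w v₁ v₂ u = 0 := by
  have : w u = 0 := by
    by_contra h; exact hu (hsupp h)
  simp [Phi_apply, this]

/-- `Φ_{v₁,v₂} ≡ 0` unless `v₁ ∈ [1/2, 2]`. [cite: GuthMaynard2026, proof of Proposition 7.1] -/
theorem Phi_eq_zero_of_notMem_left (hsupp : Function.support w ⊆ Set.Icc 1 2) {v₁ : ℝ}
    (hv : v₁ ∉ Set.Icc (1 / 2 : ℝ) 2) (v₂ u : ℝ) : Phi w v₁ v₂ u = 0 := by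
  by_cases hu : u ∈ Set.Icc 1 2
  · have : w (u * v₁) = 0 := by
      by_contra h
      have h1 := hsupp h
      apply hv
      rw [Set.mem_Icc] at hu h1 ⊢
      have hu0 : 0 < u := by linarith
      constructor
      · by_contra h2; push Not at h2
        nlinarith
      · by_contra h2; push Not at h2
        nlinarith
    simp [Phi_apply, this]
  · exact Phi_eq_zero_of_notMem hsupp v₁ v₂ hu

/-- `Φ_{v₁,v₂} ≡ 0` unless `v₂ ∈ [1/2, 2]`. [cite: GuthMaynard2026, proof of Proposition 7.1] -/
theorem Phi_eq_zero_of_notMem_right (hsupp : Function.support w ⊆ Set.Icc 1 2) (v₁ : ℝ) {v₂ : ℝ}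
    (hv : v₂ ∉ Set.Icc (1 / 2 : ℝ) 2) (u : ℝ) : Phi w v₁ v₂ u = 0 := by
  by_cases hu : u ∈ Set.Icc 1 2
  · have : w (u * v₂) = 0 := by
      by_contra h
      have h1 := hsupp h
      apply hv
      rw [Set.mem_Icc] at hu h1 ⊢
      have hu0 : 0 < u := by linarith
      constructor
      · by_contra h2; push Not at h2
        nlinarith
      · by_contra h2; push Not at h2
        nlinarith
    simp [Phi_apply, this]
  · exact Phi_eq_zero_of_notMem hsupp v₁ v₂ hu

/-- `u ↦ w(uv)²` is smooth. [folklore] -/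
theorem wSq_comp_mul_contDiff (hw : ContDiff ℝ ∞ w) (v : ℝ) : ContDiff ℝ ∞ (fun u ↦ wSq w (u * v)) :=
  (wSq_contDiff hw).comp (contDiff_id.mul contDiff_const)

/-- `(d/du)^k w(uv)² = v^k (w²)^{(k)}(uv)`. [folklore] -/
theorem iteratedDeriv_wSq_comp_mul (hw : ContDiff ℝ ∞ w) (v : ℝ) (k : ℕ) (u : ℝ) :
    iteratedDeriv k (fun u ↦ wSq w (u * v)) u = (v : ℂ) ^ k * iteratedDeriv k (wSq w) (u * v) := by
  have hk : ContDiff ℝ k (wSq w) := (wSq_contDiff hw).of_le (by exact_mod_cast le_top)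
  have h := iteratedDeriv_comp_const_smul (n := k) hk v
  have e : (fun u : ℝ ↦ wSq w (u * v)) = fun u ↦ wSq w (v * u) := by
    ext u; rw [mul_comm]
  have h' : iteratedDeriv k (fun x ↦ wSq w (v * x)) u = v ^ k • iteratedDeriv k (wSq w) (v * u) := by
    have := congrFun h u
    simpa only [smul_eq_mul] using this
  rw [e, h', Complex.real_smul, mul_comm u v]
  push_cast
  ring

/-- `Φ_{v₁,v₂}` is smooth. [cite: GuthMaynard2026, proof of Proposition 7.1] -/
theorem Phi_contDiff (hw : ContDiff ℝ ∞ w) (v₁ v₂ : ℝ) : ContDiff ℝ ∞ (Phi w v₁ v₂) := by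
  unfold Phi
  exact ((wSq_comp_mul_contDiff hw v₁).mul (wSq_comp_mul_contDiff hw v₂)).mul (wSq2_contDiff hw)

/-- `Φ_{v₁,v₂}` is supported in `[1,2]`. [cite: GuthMaynard2026, (7.4)] -/
theorem tsupport_Phi_subset (hsupp : Function.support w ⊆ Set.Icc 1 2) (v₁ v₂ : ℝ) :
    tsupport (Phi w v₁ v₂) ⊆ Set.Icc 1 2 := by
  refine closure_minimal (fun u hu ↦ ?_) isClosed_Icc
  by_contra h
  exact hu (Phi_eq_zero_of_notMem hsupp v₁ v₂ h)

/-- `Φ_{v₁,v₂}` has compact support. [cite: GuthMaynard2026, (7.4)] -/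
theorem hasCompactSupport_Phi (hsupp : Function.support w ⊆ Set.Icc 1 2) (v₁ v₂ : ℝ) :
    HasCompactSupport (Phi w v₁ v₂) :=
  HasCompactSupport.of_support_subset_isCompact isCompact_Icc
    ((subset_tsupport _).trans (tsupport_Phi_subset hsupp v₁ v₂))

/-- `Φ_{v₁,v₂}` is continuous. [cite: GuthMaynard2026, (7.4)] -/
theorem Phi_continuous (hw : ContDiff ℝ ∞ w) (v₁ v₂ : ℝ) : Continuous (Phi w v₁ v₂) :=
  (Phi_contDiff hw v₁ v₂).continuous

/-- **Uniform derivative bounds for `Φ_{v₁,v₂}`**: for every `k` there is `D` with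
`‖Φ_{v₁,v₂}^{(k)}(u)‖ ≤ D` for all `u` and all `|v₁|, |v₂| ≤ 2` ("`w₂` has `j`th derivative with
respect to `u₃` bounded by `O_j(1)`"). [cite: GuthMaynard2026, proof of Proposition 7.1] -/
theorem norm_iteratedDeriv_Phi_le (hw : ContDiff ℝ ∞ w) (hsupp : Function.support w ⊆ Set.Icc 1 2)
    (k : ℕ) : ∃ D, 0 ≤ D ∧ ∀ v₁ v₂ u : ℝ, |v₁| ≤ 2 → |v₂| ≤ 2 → ‖iteratedDeriv k (Phi w v₁ v₂) u‖ ≤ D := by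
  -- bounds for the derivatives of `w²` and of `u²w²`
  have hK := fun i ↦ exists_bound_iteratedDeriv (wSq_contDiff hw) isCompact_Icc (tsupport_wSq_subset hsupp) i
  choose K hK0 hK using hK
  have hL := fun i ↦ exists_bound_iteratedDeriv (wSq2_contDiff hw) isCompact_Icc (tsupport_wSq2_subset hsupp) i
  choose L hL0 hL using hL
  -- bounds for `u ↦ w(uv)²`, `|v| ≤ 2`
  have hKv : ∀ (v : ℝ), |v| ≤ 2 → ∀ i u, ‖iteratedDeriv i (fun u ↦ wSq w (u * v)) u‖ ≤ 2 ^ i * K i := by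
    intro v hv i u
    rw [iteratedDeriv_wSq_comp_mul hw v i u, norm_mul, norm_pow, Complex.norm_real, Real.norm_eq_abs]
    exact mul_le_mul (pow_le_pow_left₀ (abs_nonneg _) hv i) (hK i _) (norm_nonneg _) (by positivity)
  -- Leibniz twice
  set G₁ : ℕ → ℝ := fun n ↦ ∑ i ∈ Finset.range (n + 1), (n.choose i) * (2 ^ i * K i) * (2 ^ (n - i) * K (n - i))
    with hG₁
  set D : ℝ := ∑ i ∈ Finset.range (k + 1), (k.choose i) * G₁ i * L (k - i) with hD
  have hG₁0 : ∀ n, 0 ≤ G₁ n := fun n ↦ Finset.sum_nonneg fun i _ ↦ by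
    have := hK0 i; have := hK0 (n - i); positivity
  have hD0 : 0 ≤ D := Finset.sum_nonneg fun i _ ↦ by have := hG₁0 i; have := hL0 (k - i); positivity
  refine ⟨D, hD0, fun v₁ v₂ u hv₁ hv₂ ↦ ?_⟩
  have htop : ∀ {f : ℝ → ℂ}, ContDiff ℝ ∞ f → ∀ n : ℕ, ContDiffAt ℝ n f u := fun hf n ↦
    hf.contDiffAt.of_le (by exact_mod_cast le_top)
  have h12 : ∀ n, ‖iteratedDeriv n (fun u ↦ wSq w (u * v₁) * wSq w (u * v₂)) u‖ ≤ G₁ n := by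
    intro n
    exact norm_iteratedDeriv_mul_le_of_bounds (k := n) (htop (wSq_comp_mul_contDiff hw v₁) n)
      (htop (wSq_comp_mul_contDiff hw v₂) n) (K := fun i ↦ 2 ^ i * K i) (G := fun i ↦ 2 ^ i * K i)
      (fun i _ ↦ hKv v₁ hv₁ i u) (fun i _ ↦ hKv v₂ hv₂ i u)
  have hfin := norm_iteratedDeriv_mul_le_of_bounds (k := k)
    (htop ((wSq_comp_mul_contDiff hw v₁).mul (wSq_comp_mul_contDiff hw v₂)) k)
    (htop (wSq2_contDiff hw) k) (K := G₁) (G := L) (fun i _ ↦ h12 i) (fun i _ ↦ hL i u)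
  have e : Phi w v₁ v₂ = (fun u ↦ wSq w (u * v₁) * wSq w (u * v₂)) * wSq2 w := by
    ext u; simp [Phi]
  rw [e]
  exact hfin

/-- **Non-stationary phase for the `u₃`-integral**: for every `j` there is `D` such that
`|Φ̂_{v₁,v₂}(ξ)| ≤ D (1+|ξ|)^{-j}` for all `ξ` and all `|v₁|, |v₂| ≤ 2` ("the inner integral is
`O_η(T^{-300})` unless `|m₁v₁+m₂v₂+m₃| ≤ T^η/N` by repeated integration by parts. In general, the inner
integral has size `≪ 1`"). [cite: GuthMaynard2026, proof of Proposition 7.1] -/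
theorem norm_fourier_Phi_le (hw : ContDiff ℝ ∞ w) (hsupp : Function.support w ⊆ Set.Icc 1 2) (j : ℕ) :
    ∃ D, 0 ≤ D ∧ ∀ v₁ v₂ ξ : ℝ, |v₁| ≤ 2 → |v₂| ≤ 2 → ‖𝓕 (Phi w v₁ v₂) ξ‖ ≤ D / (1 + |ξ|) ^ j := by
  obtain ⟨D₀, hD₀0, hD₀⟩ := norm_iteratedDeriv_Phi_le hw hsupp 0
  obtain ⟨Dj, hDj0, hDj⟩ := norm_iteratedDeriv_Phi_le hw hsupp j
  refine ⟨2 ^ j * (D₀ + Dj), by positivity, fun v₁ v₂ ξ hv₁ hv₂ ↦ ?_⟩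
  have hL0 : ∫ u, ‖Phi w v₁ v₂ u‖ ≤ D₀ := by
    have h := integral_norm_le_of_bound_Icc (g := Phi w v₁ v₂) (a := 1) (b := 2) (C := D₀) (by norm_num)
      (fun u ↦ by simpa using hD₀ v₁ v₂ u hv₁ hv₂) (fun u hu ↦ Phi_eq_zero_of_notMem hsupp v₁ v₂ hu)
    rw [show (2 : ℝ) - 1 = 1 by norm_num, mul_one] at h
    exact h
  have hLj : ∫ u, ‖iteratedDeriv j (Phi w v₁ v₂) u‖ ≤ Dj := by
    have h := integral_norm_le_of_bound_Icc (g := iteratedDeriv j (Phi w v₁ v₂)) (a := 1) (b := 2) (C := Dj)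
      (by norm_num) (fun u ↦ hDj v₁ v₂ u hv₁ hv₂)
      (fun u hu ↦ iteratedDeriv_eq_zero_of_notMem_tsupport (fun h ↦ hu (tsupport_Phi_subset hsupp v₁ v₂ h)) j)
    rw [show (2 : ℝ) - 1 = 1 by norm_num, mul_one] at h
    exact h
  have h1ξ : 1 ≤ 1 + |ξ| := by have := abs_nonneg ξ; linarith
  by_cases hξ : |ξ| ≤ 1
  · -- trivial bound
    have h1 : ‖𝓕 (Phi w v₁ v₂) ξ‖ ≤ D₀ := (norm_fourier_le_integral_norm _ _).trans hL0
    have h2 : (1 + |ξ|) ^ j ≤ 2 ^ j := pow_le_pow_left₀ (by positivity) (by linarith) j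
    rw [le_div_iff₀ (by positivity)]
    have h3 : 0 ≤ 2 ^ j * Dj := by positivity
    calc ‖𝓕 (Phi w v₁ v₂) ξ‖ * (1 + |ξ|) ^ j ≤ D₀ * 2 ^ j := mul_le_mul h1 h2 (by positivity) hD₀0
      _ ≤ 2 ^ j * (D₀ + Dj) := by linarith
  · -- integration by parts
    push Not at hξ
    have hξ0 : ξ ≠ 0 := by intro h; rw [h, abs_zero] at hξ; linarith
    have h1 := norm_fourier_le_of_iteratedDeriv (Phi_contDiff hw v₁ v₂) (hasCompactSupport_Phi hsupp v₁ v₂) j hξ0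
    have h2 : ‖𝓕 (Phi w v₁ v₂) ξ‖ ≤ Dj / |ξ| ^ j := by
      refine h1.trans ?_
      have h3 : |ξ| ^ j ≤ (2 * π * |ξ|) ^ j :=
        pow_le_pow_left₀ (abs_nonneg _) (by nlinarith [Real.two_le_pi, abs_nonneg ξ]) j
      exact div_le_div₀ hDj0 hLj (pow_pos (by positivity) j) h3
    refine h2.trans ?_
    rw [div_le_div_iff₀ (by positivity) (by positivity)]
    have h4 : (1 + |ξ|) ^ j ≤ 2 ^ j * |ξ| ^ j := by
      rw [← mul_pow]; exact pow_le_pow_left₀ (by positivity) (by linarith) j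
    have h5 : 0 ≤ 2 ^ j * D₀ * |ξ| ^ j := by positivity
    calc Dj * (1 + |ξ|) ^ j ≤ Dj * (2 ^ j * |ξ| ^ j) := mul_le_mul_of_nonneg_left h4 hDj0
      _ ≤ 2 ^ j * (D₀ + Dj) * |ξ| ^ j := by linarith

end weight

/-! ## §4. Proposition 7.1: `I_m` as a double integral, and its bound -/

/-- The phase `N m` of the `k`-th factor. [folklore] -/
def freq (N : ℕ) (m : ℤ) : ℝ := (N : ℝ) * m

/-- One factor `e(−uξ) h_τ(u)` of the integrand of `ĥ_τ(ξ) = ∫ e(−uξ)h_τ(u)du`. [folklore] -/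
def fac (w : ℝ → ℝ) (τ ξ : ℝ) : ℝ → ℂ := fun u ↦ ech (-(u * ξ)) * hFun w τ u

/-- The integrand of `I_m` on `ℝ³` (before the change of variables):
`G_m(u₁,u₂,u₃) = ∑_{t₁,t₂,t₃} ∏_k e(−u_k N m_k) h_{τ_k}(u_k)`. [cite: GuthMaynard2026, (7.3)] -/
def Gsum (w : ℝ → ℝ) (N : ℕ) (W : Finset ℝ) (m : ℤ × ℤ × ℤ) : ℝ × ℝ × ℝ → ℂ :=
  fun p ↦ ∑ t₁ ∈ W, ∑ t₂ ∈ W, ∑ t₃ ∈ W,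
    fac w (t₁ - t₂) (freq N m.1) p.1 * (fac w (t₂ - t₃) (freq N m.2.1) p.2.1 * fac w (t₃ - t₁) (freq N m.2.2) p.2.2)

/-- The integrand after the change of variables `u₁ = u₃v₁`, `u₂ = u₃v₂`, as a function of
`(u₃, (v₁, v₂))`: `H(u₃,v₁,v₂) = u₃² G_m(u₃v₁, u₃v₂, u₃)`. [cite: GuthMaynard2026, (7.4)] -/
def Hfun (w : ℝ → ℝ) (N : ℕ) (W : Finset ℝ) (m : ℤ × ℤ × ℤ) : ℝ × ℝ × ℝ → ℂ :=
  fun z ↦ (((z.1 ^ 2 : ℝ)) : ℂ) * Gsum w N W m (z.1 * z.2.1, z.1 * z.2.2, z.1)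

/-- The phase `N(m₁v₁ + m₂v₂ + m₃)`. [cite: GuthMaynard2026, Proposition 7.1] -/
def theta (N : ℕ) (m : ℤ × ℤ × ℤ) (v₁ v₂ : ℝ) : ℝ := (N : ℝ) * (m.1 * v₁ + m.2.1 * v₂ + m.2.2)

/-- The `R`-factor `R(v₁) R(v₂/v₁) R(1/v₂)`. [cite: GuthMaynard2026, Proposition 7.1] -/
def RRR (W : Finset ℝ) (v₁ v₂ : ℝ) : ℂ := Rfun W v₁ * Rfun W (v₂ / v₁) * Rfun W (1 / v₂)

section weight

variable {w : ℝ → ℝ}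

/-- `e(−uξ) h_τ(u)` is continuous. [folklore] -/
theorem fac_continuous (hw : ContDiff ℝ ∞ w) (hsupp : Function.support w ⊆ Set.Icc 1 2) (τ ξ : ℝ) :
    Continuous (fac w τ ξ) := by
  unfold fac
  exact (continuous_ech.comp (by fun_prop)).mul (hFun_continuous hw hsupp τ)

/-- `e(−uξ) h_τ(u)` has compact support. [folklore] -/
theorem hasCompactSupport_fac (hsupp : Function.support w ⊆ Set.Icc 1 2) (τ ξ : ℝ) :
    HasCompactSupport (fac w τ ξ) := by
  unfold fac
  exact (hasCompactSupport_hFun hsupp τ).mul_left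

/-- `e(−uξ) h_τ(u)` is integrable. [folklore] -/
theorem fac_integrable (hw : ContDiff ℝ ∞ w) (hsupp : Function.support w ⊆ Set.Icc 1 2) (τ ξ : ℝ) :
    Integrable (fac w τ ξ) :=
  (fac_continuous hw hsupp τ ξ).integrable_of_hasCompactSupport (hasCompactSupport_fac hsupp τ ξ)

/-- `ĥ_τ(ξ) = ∫ e(−uξ) h_τ(u) du`. [folklore] -/
theorem fourier_hFun_eq (τ ξ : ℝ) : 𝓕 (hFun w τ) ξ = ∫ u, fac w τ ξ u :=
  fourier_eq_integral_ech _ _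

/-- `e(−uξ)h_τ(u) = 0` for `u ∉ [1,2]`. [folklore] -/
theorem fac_eq_zero_of_notMem (hsupp : Function.support w ⊆ Set.Icc 1 2) (τ ξ : ℝ) {u : ℝ}
    (hu : u ∉ Set.Icc 1 2) : fac w τ ξ u = 0 := by
  rw [fac, hFun_eq_zero_of_notMem hsupp τ hu, mul_zero]

/-- **Step 1: `I_m = N³ ∫_{ℝ³} G_m`** (the product of the three Fourier integrals is an integral over
`ℝ³`, and the finite `t`-sums commute with it). [cite: GuthMaynard2026, (7.3)] -/
theorem Im_eq_integral_Gsum (hw : ContDiff ℝ ∞ w) (hsupp : Function.support w ⊆ Set.Icc 1 2) (N : ℕ)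
    (W : Finset ℝ) (m : ℤ × ℤ × ℤ) : Im w N W m = (N : ℂ) ^ 3 * ∫ p, Gsum w N W m p := by
  have hterm : ∀ t₁ t₂ t₃ : ℝ,
      𝓕 (hFun w (t₁ - t₂)) (N * m.1) * 𝓕 (hFun w (t₂ - t₃)) (N * m.2.1) * 𝓕 (hFun w (t₃ - t₁)) (N * m.2.2) =
      ∫ p : ℝ × ℝ × ℝ, fac w (t₁ - t₂) (freq N m.1) p.1 *
        (fac w (t₂ - t₃) (freq N m.2.1) p.2.1 * fac w (t₃ - t₁) (freq N m.2.2) p.2.2) := by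
    intro t₁ t₂ t₃
    have e1 : ∫ p : ℝ × ℝ × ℝ, fac w (t₁ - t₂) (freq N m.1) p.1 *
        (fac w (t₂ - t₃) (freq N m.2.1) p.2.1 * fac w (t₃ - t₁) (freq N m.2.2) p.2.2) =
        (∫ u, fac w (t₁ - t₂) (freq N m.1) u) *
          ∫ q : ℝ × ℝ, fac w (t₂ - t₃) (freq N m.2.1) q.1 * fac w (t₃ - t₁) (freq N m.2.2) q.2 :=
      integral_prod_mul (fac w (t₁ - t₂) (freq N m.1))
        (fun q : ℝ × ℝ ↦ fac w (t₂ - t₃) (freq N m.2.1) q.1 * fac w (t₃ - t₁) (freq N m.2.2) q.2)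
    have e2 : ∫ q : ℝ × ℝ, fac w (t₂ - t₃) (freq N m.2.1) q.1 * fac w (t₃ - t₁) (freq N m.2.2) q.2 =
        (∫ u, fac w (t₂ - t₃) (freq N m.2.1) u) * ∫ u, fac w (t₃ - t₁) (freq N m.2.2) u :=
      integral_prod_mul (fac w (t₂ - t₃) (freq N m.2.1)) (fac w (t₃ - t₁) (freq N m.2.2))
    rw [e1, e2, fourier_hFun_eq, fourier_hFun_eq, fourier_hFun_eq]
    simp only [freq]
    ring
  have hint : ∀ t₁ t₂ t₃ : ℝ, Integrable (fun p : ℝ × ℝ × ℝ ↦ fac w (t₁ - t₂) (freq N m.1) p.1 *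
      (fac w (t₂ - t₃) (freq N m.2.1) p.2.1 * fac w (t₃ - t₁) (freq N m.2.2) p.2.2)) := by
    intro t₁ t₂ t₃
    exact (fac_integrable hw hsupp _ _).mul_prod
      ((fac_integrable hw hsupp _ _).mul_prod (fac_integrable hw hsupp _ _))
  rw [Im]
  congr 1
  simp_rw [hterm]
  unfold Gsum
  rw [integral_finsetSum _ (fun t₁ _ ↦ integrable_finsetSum _ fun t₂ _ ↦
    integrable_finsetSum _ fun t₃ _ ↦ hint t₁ t₂ t₃)]
  refine Finset.sum_congr rfl fun t₁ _ ↦ ?_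
  rw [integral_finsetSum _ (fun t₂ _ ↦ integrable_finsetSum _ fun t₃ _ ↦ hint t₁ t₂ t₃)]
  refine Finset.sum_congr rfl fun t₂ _ ↦ ?_
  rw [integral_finsetSum _ (fun t₃ _ ↦ hint t₁ t₂ t₃)]

/-- `G_m` is integrable on `ℝ³`. [folklore] -/
theorem Gsum_integrable (hw : ContDiff ℝ ∞ w) (hsupp : Function.support w ⊆ Set.Icc 1 2) (N : ℕ)
    (W : Finset ℝ) (m : ℤ × ℤ × ℤ) : Integrable (Gsum w N W m) := by
  unfold Gsum
  refine integrable_finsetSum _ fun t₁ _ ↦ integrable_finsetSum _ fun t₂ _ ↦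
    integrable_finsetSum _ fun t₃ _ ↦ ?_
  exact (fac_integrable hw hsupp _ _).mul_prod
    ((fac_integrable hw hsupp _ _).mul_prod (fac_integrable hw hsupp _ _))

/-- `G_m` is continuous. [folklore] -/
theorem Gsum_continuous (hw : ContDiff ℝ ∞ w) (hsupp : Function.support w ⊆ Set.Icc 1 2) (N : ℕ)
    (W : Finset ℝ) (m : ℤ × ℤ × ℤ) : Continuous (Gsum w N W m) := by
  unfold Gsum
  refine continuous_finsetSum _ fun t₁ _ ↦ continuous_finsetSum _ fun t₂ _ ↦
    continuous_finsetSum _ fun t₃ _ ↦ ?_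
  exact ((fac_continuous hw hsupp _ _).comp continuous_fst).mul
    (((fac_continuous hw hsupp _ _).comp (continuous_fst.comp continuous_snd)).mul
      ((fac_continuous hw hsupp _ _).comp (continuous_snd.comp continuous_snd)))

/-- **The factorisation of `G_m`** (eq. (7.3)):
`G_m(u) = e(−u₁ξ₁)e(−u₂ξ₂)e(−u₃ξ₃) · w(u₁)²w(u₂)²w(u₃)² R(u₁/u₃)R(u₂/u₁)R(u₃/u₂)`. [cite: GuthMaynard2026, (7.3)] -/
theorem Gsum_eq (hsupp : Function.support w ⊆ Set.Icc 1 2) (N : ℕ) (W : Finset ℝ) (m : ℤ × ℤ × ℤ)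
    (u₁ u₂ u₃ : ℝ) : Gsum w N W m (u₁, u₂, u₃) =
      ech (-(u₁ * freq N m.1)) * ech (-(u₂ * freq N m.2.1)) * ech (-(u₃ * freq N m.2.2)) *
        (wSq w u₁ * wSq w u₂ * wSq w u₃ * (Rfun W (u₁ / u₃) * Rfun W (u₂ / u₁) * Rfun W (u₃ / u₂))) := by
  rw [← sum_hFun_mul_eq hsupp W u₁ u₂ u₃, Gsum]
  simp only [fac, Finset.mul_sum]
  refine Finset.sum_congr rfl fun t₁ _ ↦ Finset.sum_congr rfl fun t₂ _ ↦ Finset.sum_congr rfl fun t₃ _ ↦ ?_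
  ring

/-- `G_m(u) = 0` as soon as one `u_k ∉ [1,2]`. [folklore] -/
theorem Gsum_eq_zero (hsupp : Function.support w ⊆ Set.Icc 1 2) (N : ℕ) (W : Finset ℝ) (m : ℤ × ℤ × ℤ)
    {u₁ u₂ u₃ : ℝ} (h : u₁ ∉ Set.Icc 1 2 ∨ u₂ ∉ Set.Icc 1 2 ∨ u₃ ∉ Set.Icc 1 2) :
    Gsum w N W m (u₁, u₂, u₃) = 0 := by
  unfold Gsum
  refine Finset.sum_eq_zero fun t₁ _ ↦ Finset.sum_eq_zero fun t₂ _ ↦ Finset.sum_eq_zero fun t₃ _ ↦ ?_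
  rcases h with h | h | h
  · simp [fac_eq_zero_of_notMem hsupp _ _ h]
  · simp [fac_eq_zero_of_notMem hsupp _ _ h]
  · simp [fac_eq_zero_of_notMem hsupp _ _ h]

/-- **Step 2: Fubini**, `∫_{ℝ³} G_m = ∫du₃ ∫du₂ ∫du₁ G_m(u₁,u₂,u₃)`. [folklore] -/
theorem integral_Gsum_eq_iterated (hw : ContDiff ℝ ∞ w) (hsupp : Function.support w ⊆ Set.Icc 1 2) (N : ℕ)
    (W : Finset ℝ) (m : ℤ × ℤ × ℤ) :
    ∫ p, Gsum w N W m p = ∫ u₃ : ℝ, ∫ u₂ : ℝ, ∫ u₁ : ℝ, Gsum w N W m (u₁, u₂, u₃) := by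
  have hG := Gsum_integrable hw hsupp N W m
  have hG1 : Integrable (fun q : ℝ × ℝ ↦ ∫ u₁ : ℝ, Gsum w N W m (u₁, q)) := hG.integral_prod_right
  have e1 : ∫ p, Gsum w N W m p = ∫ q : ℝ × ℝ, ∫ u₁ : ℝ, Gsum w N W m (u₁, q) := integral_prod_symm _ hG
  have e2 : ∫ q : ℝ × ℝ, ∫ u₁ : ℝ, Gsum w N W m (u₁, q) = ∫ u₃ : ℝ, ∫ u₂ : ℝ, ∫ u₁ : ℝ, Gsum w N W m (u₁, u₂, u₃) :=
    integral_prod_symm _ hG1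
  rw [e1, e2]

/-- **Step 3: the substitutions `u₁ = u₃v₁`, `u₂ = u₃v₂`** (for every `u₃`; both sides vanish for
`u₃ ∉ [1,2]`): `∫du₂∫du₁ G_m(u₁,u₂,u₃) = u₃² ∫dv₂∫dv₁ G_m(u₃v₁,u₃v₂,u₃)` ("A Jacobian computation shows
that `du₁du₂du₃ = u₃²dv₁dv₂du₃`"). [cite: GuthMaynard2026, proof of Proposition 7.1] -/
theorem integral_Gsum_subst (hsupp : Function.support w ⊆ Set.Icc 1 2) (N : ℕ) (W : Finset ℝ)
    (m : ℤ × ℤ × ℤ) (u₃ : ℝ) :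
    ∫ u₂ : ℝ, ∫ u₁ : ℝ, Gsum w N W m (u₁, u₂, u₃) =
      (((u₃ ^ 2 : ℝ)) : ℂ) * ∫ v₂ : ℝ, ∫ v₁ : ℝ, Gsum w N W m (u₃ * v₁, u₃ * v₂, u₃) := by
  rcases eq_or_ne u₃ 0 with rfl | hu
  · have h0 : ∀ u₁ u₂ : ℝ, Gsum w N W m (u₁, u₂, 0) = 0 := fun u₁ u₂ ↦
      Gsum_eq_zero hsupp N W m (Or.inr (Or.inr (by norm_num)))
    simp [h0]
  · -- the general substitution `∫ g(y) dy = |a| ∫ g(a x) dx`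
    have hsub : ∀ g : ℝ → ℂ, ∫ y, g y = ((|u₃| : ℝ) : ℂ) * ∫ x, g (u₃ * x) := by
      intro g
      have h := Measure.integral_comp_mul_left g u₃
      rw [h, Complex.real_smul, ← mul_assoc, abs_inv]
      have : ((|u₃| : ℝ) : ℂ) * (((|u₃|⁻¹ : ℝ)) : ℂ) = 1 := by
        rw [← Complex.ofReal_mul, mul_inv_cancel₀ (abs_ne_zero.mpr hu)]; simp
      rw [this, one_mul]
    have h1 : ∀ u₂ : ℝ, ∫ u₁ : ℝ, Gsum w N W m (u₁, u₂, u₃) =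
        ((|u₃| : ℝ) : ℂ) * ∫ v₁ : ℝ, Gsum w N W m (u₃ * v₁, u₂, u₃) := fun u₂ ↦
      hsub (fun u₁ ↦ Gsum w N W m (u₁, u₂, u₃))
    simp_rw [h1]
    rw [integral_const_mul, hsub (fun u₂ ↦ ∫ v₁ : ℝ, Gsum w N W m (u₃ * v₁, u₂, u₃)), ← mul_assoc,
      ← Complex.ofReal_mul, ← sq, sq_abs]

/-- `H` is continuous. [folklore] -/
theorem Hfun_continuous (hw : ContDiff ℝ ∞ w) (hsupp : Function.support w ⊆ Set.Icc 1 2) (N : ℕ)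
    (W : Finset ℝ) (m : ℤ × ℤ × ℤ) : Continuous (Hfun w N W m) := by
  unfold Hfun
  refine (Complex.continuous_ofReal.comp (continuous_fst.pow 2)).mul ?_
  exact (Gsum_continuous hw hsupp N W m).comp (by fun_prop)

/-- If `1 ≤ u ≤ 2` and `1 ≤ uv ≤ 2` then `1/2 ≤ v ≤ 2`. [folklore] -/
theorem mem_Icc_of_mul_mem {u v : ℝ} (hu : u ∈ Set.Icc (1 : ℝ) 2) (huv : u * v ∈ Set.Icc (1 : ℝ) 2) :
    v ∈ Set.Icc (1 / 2 : ℝ) 2 := by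
  rw [Set.mem_Icc] at hu huv ⊢
  have hu0 : 0 < u := by linarith
  constructor
  · by_contra h; push Not at h; nlinarith
  · by_contra h; push Not at h; nlinarith

/-- `H(u₃,v₁,v₂) = 0` unless `u₃ ∈ [1,2]` and `v₁, v₂ ∈ [1/2,2]`. [folklore] -/
theorem Hfun_eq_zero (hsupp : Function.support w ⊆ Set.Icc 1 2) (N : ℕ) (W : Finset ℝ) (m : ℤ × ℤ × ℤ)
    {z : ℝ × ℝ × ℝ} (hz : z ∉ Set.Icc (1 : ℝ) 2 ×ˢ (Set.Icc (1 / 2 : ℝ) 2 ×ˢ Set.Icc (1 / 2 : ℝ) 2)) :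
    Hfun w N W m z = 0 := by
  obtain ⟨u₃, v₁, v₂⟩ := z
  simp only [Set.mem_prod, not_and_or] at hz
  unfold Hfun
  simp only
  suffices h : Gsum w N W m (u₃ * v₁, u₃ * v₂, u₃) = 0 by rw [h, mul_zero]
  apply Gsum_eq_zero hsupp
  by_contra hall
  simp only [not_or, not_not] at hall
  obtain ⟨h1, h2, h3⟩ := hall
  rcases hz with hz | hz | hz
  · exact hz h3
  · exact hz (mem_Icc_of_mul_mem h3 h1)
  · exact hz (mem_Icc_of_mul_mem h3 h2)

/-- `H` has compact support. [folklore] -/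
theorem hasCompactSupport_Hfun (hsupp : Function.support w ⊆ Set.Icc 1 2) (N : ℕ) (W : Finset ℝ)
    (m : ℤ × ℤ × ℤ) : HasCompactSupport (Hfun w N W m) := by
  refine HasCompactSupport.of_support_subset_isCompact
    (K := Set.Icc (1 : ℝ) 2 ×ˢ (Set.Icc (1 / 2 : ℝ) 2 ×ˢ Set.Icc (1 / 2 : ℝ) 2))
    (isCompact_Icc.prod (isCompact_Icc.prod isCompact_Icc)) fun z hz ↦ ?_
  by_contra h
  exact hz (Hfun_eq_zero hsupp N W m h)

/-- `H` is integrable on `ℝ³`. [folklore] -/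
theorem Hfun_integrable (hw : ContDiff ℝ ∞ w) (hsupp : Function.support w ⊆ Set.Icc 1 2) (N : ℕ)
    (W : Finset ℝ) (m : ℤ × ℤ × ℤ) : Integrable (Hfun w N W m) :=
  (Hfun_continuous hw hsupp N W m).integrable_of_hasCompactSupport (hasCompactSupport_Hfun hsupp N W m)

/-- Each `u₃`-slice `(v₁,v₂) ↦ H(u₃,v₁,v₂)` is integrable on `ℝ²`. [folklore] -/
theorem Hfun_slice_integrable (hw : ContDiff ℝ ∞ w) (hsupp : Function.support w ⊆ Set.Icc 1 2) (N : ℕ)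
    (W : Finset ℝ) (m : ℤ × ℤ × ℤ) (u₃ : ℝ) : Integrable (fun q : ℝ × ℝ ↦ Hfun w N W m (u₃, q)) := by
  have hc : Continuous (fun q : ℝ × ℝ ↦ Hfun w N W m (u₃, q)) :=
    (Hfun_continuous hw hsupp N W m).comp (by fun_prop)
  refine hc.integrable_of_hasCompactSupport ?_
  refine HasCompactSupport.of_support_subset_isCompact (K := Set.Icc (1 / 2 : ℝ) 2 ×ˢ Set.Icc (1 / 2 : ℝ) 2)
    (isCompact_Icc.prod isCompact_Icc) fun q hq ↦ ?_
  by_contra h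
  apply hq
  apply Hfun_eq_zero hsupp N W m
  simp only [Set.mem_prod, not_and_or]
  simp only [Set.mem_prod, not_and_or] at h
  exact Or.inr h

/-- **Step 4: Fubini again**, `∫du₃ u₃² ∫dv₂∫dv₁ G_m(u₃v₁,u₃v₂,u₃) = ∫dv₁∫dv₂∫du₃ H(u₃,v₁,v₂)`.
[cite: GuthMaynard2026, proof of Proposition 7.1] -/
theorem integral_subst_eq_iterated (hw : ContDiff ℝ ∞ w) (hsupp : Function.support w ⊆ Set.Icc 1 2) (N : ℕ)
    (W : Finset ℝ) (m : ℤ × ℤ × ℤ) :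
    ∫ u₃ : ℝ, (((u₃ ^ 2 : ℝ)) : ℂ) * ∫ v₂ : ℝ, ∫ v₁ : ℝ, Gsum w N W m (u₃ * v₁, u₃ * v₂, u₃) =
      ∫ v₁ : ℝ, ∫ v₂ : ℝ, ∫ u₃ : ℝ, Hfun w N W m (u₃, v₁, v₂) := by
  have hH := Hfun_integrable hw hsupp N W m
  -- the inner double integral as an integral over `ℝ²`
  have h1 : ∀ u₃ : ℝ, (((u₃ ^ 2 : ℝ)) : ℂ) * ∫ v₂ : ℝ, ∫ v₁ : ℝ, Gsum w N W m (u₃ * v₁, u₃ * v₂, u₃) =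
      ∫ q : ℝ × ℝ, Hfun w N W m (u₃, q) := by
    intro u₃
    have e : ∫ q : ℝ × ℝ, Hfun w N W m (u₃, q) = ∫ v₂ : ℝ, ∫ v₁ : ℝ, Hfun w N W m (u₃, v₁, v₂) :=
      integral_prod_symm _ (Hfun_slice_integrable hw hsupp N W m u₃)
    rw [e, ← integral_const_mul]
    refine integral_congr_ae (Eventually.of_forall fun v₂ ↦ ?_)
    simp only
    rw [← integral_const_mul]
    rfl
  simp_rw [h1]
  calc ∫ u₃ : ℝ, ∫ q : ℝ × ℝ, Hfun w N W m (u₃, q) = ∫ z, Hfun w N W m z := (integral_prod _ hH).symm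
    _ = ∫ q : ℝ × ℝ, ∫ u₃ : ℝ, Hfun w N W m (u₃, q) := integral_prod_symm _ hH
    _ = ∫ v₁ : ℝ, ∫ v₂ : ℝ, ∫ u₃ : ℝ, Hfun w N W m (u₃, v₁, v₂) := integral_prod _ hH.integral_prod_right

/-- **Step 5: the inner `u₃`-integral is a Fourier transform of `Φ_{v₁,v₂}`**:
`∫ H(u₃,v₁,v₂) du₃ = R(v₁)R(v₂/v₁)R(1/v₂) · Φ̂_{v₁,v₂}(N(m₁v₁+m₂v₂+m₃))` ("the exponential factor also
works out in a nice way in the new variables"). [cite: GuthMaynard2026, proof of Proposition 7.1] -/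
theorem integral_Hfun_eq (hsupp : Function.support w ⊆ Set.Icc 1 2) (N : ℕ) (W : Finset ℝ)
    (m : ℤ × ℤ × ℤ) (v₁ v₂ : ℝ) :
    ∫ u₃ : ℝ, Hfun w N W m (u₃, v₁, v₂) = RRR W v₁ v₂ * 𝓕 (Phi w v₁ v₂) (theta N m v₁ v₂) := by
  have hpt : ∀ u₃ : ℝ, Hfun w N W m (u₃, v₁, v₂) =
      RRR W v₁ v₂ * (ech (-(u₃ * theta N m v₁ v₂)) * Phi w v₁ v₂ u₃) := by
    intro u₃
    rcases eq_or_ne u₃ 0 with rfl | hu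
    · simp [Hfun, Phi_eq_zero_of_notMem hsupp v₁ v₂ (show (0 : ℝ) ∉ Set.Icc 1 2 by norm_num)]
    · unfold Hfun
      simp only
      rw [Gsum_eq hsupp]
      have e1 : ech (-(u₃ * v₁ * freq N m.1)) * ech (-(u₃ * v₂ * freq N m.2.1)) * ech (-(u₃ * freq N m.2.2)) =
          ech (-(u₃ * theta N m v₁ v₂)) := by
        rw [← ech_add, ← ech_add]
        congr 1
        simp only [freq, theta]
        ring
      have e2 : u₃ * v₁ / u₃ = v₁ := by field_simp
      have e3 : u₃ * v₂ / (u₃ * v₁) = v₂ / v₁ := by rw [mul_div_mul_left _ _ hu]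
      have e4 : u₃ / (u₃ * v₂) = 1 / v₂ := by rw [div_mul_eq_div_div, div_self hu]
      rw [e2, e3, e4]
      have e5 : (((u₃ ^ 2 : ℝ)) : ℂ) * (wSq w (u₃ * v₁) * wSq w (u₃ * v₂) * wSq w u₃) = Phi w v₁ v₂ u₃ := by
        simp only [Phi, wSq, wSq2]; push_cast; ring
      rw [← e1, RRR, ← e5]
      ring
  simp_rw [hpt]
  rw [integral_const_mul, fourier_eq_integral_ech]

/-- **Guth–Maynard Proposition 7.1, exact form**:
`I_m = N³ ∫dv₁ ∫dv₂ R(v₁)R(v₂/v₁)R(1/v₂) Φ̂_{v₁,v₂}(N(m₁v₁+m₂v₂+m₃))`. [cite: GuthMaynard2026, Proposition 7.1] -/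
theorem Im_eq_integral (hw : ContDiff ℝ ∞ w) (hsupp : Function.support w ⊆ Set.Icc 1 2) (N : ℕ)
    (W : Finset ℝ) (m : ℤ × ℤ × ℤ) :
    Im w N W m = (N : ℂ) ^ 3 * ∫ v₁ : ℝ, ∫ v₂ : ℝ, RRR W v₁ v₂ * 𝓕 (Phi w v₁ v₂) (theta N m v₁ v₂) := by
  rw [Im_eq_integral_Gsum hw hsupp, integral_Gsum_eq_iterated hw hsupp]
  simp_rw [integral_Gsum_subst hsupp N W m]
  rw [integral_subst_eq_iterated hw hsupp]
  simp_rw [integral_Hfun_eq hsupp N W m]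

/-- `|R(1/v)| = |R(v)|`. [folklore] -/
theorem norm_Rfun_inv (W : Finset ℝ) (v : ℝ) : ‖Rfun W (1 / v)‖ = ‖Rfun W v‖ := by
  have h : Rfun W (1 / v) = (starRingEnd ℂ) (Rfun W v) := by
    rw [Rfun, Rfun, map_sum]
    refine Finset.sum_congr rfl fun t _ ↦ ?_
    rw [ePow, ePow, ← Complex.exp_conj, one_div, abs_inv, Real.log_inv]
    congr 1
    simp only [map_mul, Complex.conj_ofReal, Complex.conj_I]
    push_cast; ring
  rw [h, Complex.norm_conj]

/-- `R` is measurable. [folklore] -/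
theorem measurable_Rfun (W : Finset ℝ) : Measurable (Rfun W) := by
  unfold Rfun
  refine Finset.measurable_sum _ fun t _ ↦ ?_
  unfold ePow
  exact Complex.measurable_exp.comp ((Complex.measurable_ofReal.comp
    (Real.measurable_log.comp measurable_abs)).mul_const _)

set_option maxHeartbeats 800000 in
/-- **Guth–Maynard Proposition 7.1 (Cancellation within the `I_m` integrals)**: for every `j` there
is `D` (depending on `w` and `j` only) such that for all `N`, all finite `W ⊂ ℝ` and all `m ∈ ℤ³`,
`|I_m| ≤ N³ ∫_{1/2}^{2} ∫_{1/2}^{2} |R(v₁)||R(v₂/v₁)||R(v₂)| · D(1+|N(m₁v₁+m₂v₂+m₃)|)^{-j} dv₂ dv₁`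
("`|I_m| ≪ N³∫_{|m₁v₁+m₂v₂+m₃| ⪅ 1/N, v₁≍v₂≍1} |R(v₁)R(v₂/v₁)R(v₂)| dv₁dv₂ + O(T^{-200})`").
[cite: GuthMaynard2026, Proposition 7.1] -/
theorem norm_Im_le (hw : ContDiff ℝ ∞ w) (hsupp : Function.support w ⊆ Set.Icc 1 2) (j : ℕ) :
    ∃ D, 0 ≤ D ∧ ∀ (N : ℕ) (W : Finset ℝ) (m : ℤ × ℤ × ℤ),
      ‖Im w N W m‖ ≤ (N : ℝ) ^ 3 * ∫ v₁ in Set.Icc (1 / 2 : ℝ) 2, ∫ v₂ in Set.Icc (1 / 2 : ℝ) 2,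
        ‖Rfun W v₁‖ * ‖Rfun W (v₂ / v₁)‖ * ‖Rfun W v₂‖ * (D / (1 + |theta N m v₁ v₂|) ^ j) := by
  obtain ⟨D, hD0, hD⟩ := norm_fourier_Phi_le hw hsupp j
  refine ⟨D, hD0, fun N W m ↦ ?_⟩
  have hH := Hfun_integrable hw hsupp N W m
  set box : Set (ℝ × ℝ) := Set.Icc (1 / 2 : ℝ) 2 ×ˢ Set.Icc (1 / 2 : ℝ) 2 with hbox
  have hboxm : MeasurableSet box := measurableSet_Icc.prod measurableSet_Icc
  -- `I_m = N³ ∫_q F(q)` with `F(q) = ∫ H(u₃, q) du₃`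
  set F : ℝ × ℝ → ℂ := fun q ↦ ∫ u₃ : ℝ, Hfun w N W m (u₃, q) with hF
  have hFi : Integrable F := hH.integral_prod_right
  have hIm : Im w N W m = (N : ℂ) ^ 3 * ∫ q, F q := by
    rw [Im_eq_integral_Gsum hw hsupp, integral_Gsum_eq_iterated hw hsupp]
    simp_rw [integral_Gsum_subst hsupp N W m]
    have h1 : ∀ u₃ : ℝ, (((u₃ ^ 2 : ℝ)) : ℂ) * ∫ v₂ : ℝ, ∫ v₁ : ℝ, Gsum w N W m (u₃ * v₁, u₃ * v₂, u₃) =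
        ∫ q : ℝ × ℝ, Hfun w N W m (u₃, q) := by
      intro u₃
      have e : ∫ q : ℝ × ℝ, Hfun w N W m (u₃, q) = ∫ v₂ : ℝ, ∫ v₁ : ℝ, Hfun w N W m (u₃, v₁, v₂) :=
        integral_prod_symm _ (Hfun_slice_integrable hw hsupp N W m u₃)
      rw [e, ← integral_const_mul]
      refine integral_congr_ae (Eventually.of_forall fun v₂ ↦ ?_)
      simp only
      rw [← integral_const_mul]
      rfl
    simp_rw [h1]
    have e1 : ∫ u₃ : ℝ, ∫ q : ℝ × ℝ, Hfun w N W m (u₃, q) = ∫ q : ℝ × ℝ, F q :=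
      (integral_prod _ hH).symm.trans (integral_prod_symm _ hH)
    rw [e1]
  -- the majorant
  set maj : ℝ × ℝ → ℝ := fun q ↦ ‖Rfun W q.1‖ * ‖Rfun W (q.2 / q.1)‖ * ‖Rfun W q.2‖ *
    (D / (1 + |theta N m q.1 q.2|) ^ j) with hmaj
  have hmaj0 : ∀ q, 0 ≤ maj q := fun q ↦ by positivity
  have hmajm : Measurable maj := by
    have h1 : Measurable fun q : ℝ × ℝ ↦ ‖Rfun W q.1‖ := (measurable_Rfun W).norm.comp measurable_fst
    have h2 : Measurable fun q : ℝ × ℝ ↦ ‖Rfun W (q.2 / q.1)‖ :=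
      (measurable_Rfun W).norm.comp (measurable_snd.div measurable_fst)
    have h3 : Measurable fun q : ℝ × ℝ ↦ ‖Rfun W q.2‖ := (measurable_Rfun W).norm.comp measurable_snd
    have h4 : Measurable fun q : ℝ × ℝ ↦ D / (1 + |theta N m q.1 q.2|) ^ j := by
      unfold theta; fun_prop
    exact ((h1.mul h2).mul h3).mul h4
  have hmajb : ∀ q, maj q ≤ (W.card : ℝ) ^ 3 * D := by
    intro q
    have h1 := norm_Rfun_le W q.1
    have h2 := norm_Rfun_le W (q.2 / q.1)
    have h3 := norm_Rfun_le W q.2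
    have h4 : D / (1 + |theta N m q.1 q.2|) ^ j ≤ D := by
      refine div_le_self hD0 ?_
      exact one_le_pow₀ (by have := abs_nonneg (theta N m q.1 q.2); linarith)
    calc maj q = ‖Rfun W q.1‖ * ‖Rfun W (q.2 / q.1)‖ * ‖Rfun W q.2‖ * (D / (1 + |theta N m q.1 q.2|) ^ j) := rfl
      _ ≤ W.card * W.card * W.card * D := by gcongr
      _ = (W.card : ℝ) ^ 3 * D := by ring
  have hmaji : IntegrableOn maj box := by
    refine Measure.integrableOn_of_bounded (M := (W.card : ℝ) ^ 3 * D) ?_ hmajm.aestronglyMeasurable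
      (Eventually.of_forall fun q ↦ ?_)
    · rw [hbox, Measure.volume_eq_prod, Measure.prod_prod, Real.volume_Icc]
      exact ENNReal.mul_ne_top ENNReal.ofReal_ne_top ENNReal.ofReal_ne_top
    · rw [Real.norm_of_nonneg (hmaj0 q)]; exact hmajb q
  have hmaji' : Integrable (box.indicator maj) := (integrable_indicator_iff hboxm).mpr hmaji
  -- pointwise bound `‖F q‖ ≤ 1_box(q) maj(q)`
  have hpt : ∀ q, ‖F q‖ ≤ box.indicator maj q := by
    intro q
    obtain ⟨v₁, v₂⟩ := q
    have hFq : F (v₁, v₂) = RRR W v₁ v₂ * 𝓕 (Phi w v₁ v₂) (theta N m v₁ v₂) := integral_Hfun_eq hsupp N W m v₁ v₂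
    rw [hFq]
    by_cases hq : (v₁, v₂) ∈ box
    · rw [Set.indicator_of_mem hq]
      rw [hbox, Set.mem_prod, Set.mem_Icc, Set.mem_Icc] at hq
      have hv₁ : |v₁| ≤ 2 := by rw [abs_le]; constructor <;> linarith [hq.1.1, hq.1.2]
      have hv₂ : |v₂| ≤ 2 := by rw [abs_le]; constructor <;> linarith [hq.2.1, hq.2.2]
      rw [norm_mul, RRR, norm_mul, norm_mul, norm_Rfun_inv]
      exact mul_le_mul_of_nonneg_left (hD v₁ v₂ _ hv₁ hv₂) (by positivity)
    · rw [Set.indicator_of_notMem hq]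
      have hzero : Phi w v₁ v₂ = 0 := by
        rw [hbox, Set.mem_prod, not_and_or] at hq
        ext u
        rcases hq with hq | hq
        · exact Phi_eq_zero_of_notMem_left hsupp hq v₂ u
        · exact Phi_eq_zero_of_notMem_right hsupp v₁ hq u
      rw [hzero]
      have : 𝓕 (0 : ℝ → ℂ) (theta N m v₁ v₂) = 0 := by
        rw [fourier_eq_integral_ech]; simp
      rw [this, mul_zero, norm_zero]
  -- conclusion
  rw [hIm, norm_mul]
  have hN : ‖((N : ℂ)) ^ 3‖ = (N : ℝ) ^ 3 := by simp
  rw [hN]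
  refine mul_le_mul_of_nonneg_left ?_ (by positivity)
  calc ‖∫ q, F q‖ ≤ ∫ q, ‖F q‖ := norm_integral_le_integral_norm _
    _ ≤ ∫ q, box.indicator maj q := integral_mono hFi.norm hmaji' hpt
    _ = ∫ q in box, maj q := integral_indicator hboxm
    _ = ∫ v₁ in Set.Icc (1 / 2 : ℝ) 2, ∫ v₂ in Set.Icc (1 / 2 : ℝ) 2, maj (v₁, v₂) := setIntegral_prod maj hmaji

end weight

end GuthMaynardS3

end Literature.NumberTheory.LFunctions

end
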